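import Summits.HodgeConjecture.HodgeConjecture.Theorems.Ring2AbelianAllWeilCellsAnchorPointedClosed
import Summits.HodgeConjecture.HodgeConjecture.Theorems.Ring2AbelianAllWeilSimilarAnchors
import HarnessLib

/-!
# Ring 2 · AbelianAll (ab-weil-1, gen 10, part 8h) — the dim ≤ 5 consequence as CENSUS EDGES into
  `ClassTargets.HCUpToDim 5`, from CLOSED nodes (both residual shapes of the Weil column)

research route, not a corollary; conditional on HC_CM plus one named minimal statement.
Cell line: research route conditional on HC_CM; not a corollary; Q11.4-sentence-2 already refuted in dim ≥ 3.
`HC_CM` (`Theses.RankFourFaces.CMAbelianHodge`) does not occur in this file and no open case of the Hodge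
conjecture is claimed.

## What is PROVED here (0 sorry; LEAD gen 23 supplement, suggestion "a closed `… → ClassTargets.HCUpToDim 5`
corollary of the 8d Σ-rows would make the dim ≤ 5 consequence a census edge")

`ClassTargets.HCUpToDim 5` (`= ∀ A, dim A ≤ 5 → HodgeConjectureFor A.dim A.X`, typer1's class-target node) from
CLOSED (binder-free) nodes only:

* §1 residual shape of record (parts 7 / 8d): the four refereed print facts (Moonen–Zarhin 1999, Koike 2004,
  Schoen 1998, Markman 2023) + N76 `IsogenyConnectedToCMAnchorFourfoldCells` + R∞^var
  `WeilTypeLadder.WeilVariationalHodgeQuadratic` ⟹ `HCUpToDim 5`; and the coarser N75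
  `IsogenyConnectedToCMAnchorAllCells` form.
* §2 door-B shape (part 8g): two closed nodes `HasLocallyAlgebraicWeilAnchorFourfoldCells` (one locally
  algebraic anchor in every positive non-split squarefree fourfold cell) and `HasLocallyAlgebraicWeilAnchorAllCells`;
  the four refereed facts + `HodgeTheory.weilFamilyReach_similar` (NAMED print fact, Deligne LNM 900 proof of
  Thm. 4.8) + `HasLocallyAlgebraicWeilAnchorFourfoldCells` ⟹ `HCUpToDim 5`; `weilFamilyReach_similar` +
  `HasLocallyAlgebraicWeilAnchorAllCells` ⟹ `WeilClassesByComponent` and ⟹ R1 `WeilSixfolds`.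

What is NOT proved or claimed: any of the nodes; `HC` for any abelian variety not already covered in the tree.
No Literature fact is introduced; no internally-minted statement is cited as a fact.

## References

* [MoonenZarhin1999] B. Moonen, Yu. Zarhin (1999), Thm. 0.1.
* [Deligne1982HodgeCycles] P. Deligne, LNM 900 (1982), proof of Thm. 4.8.
* [vanGeemen1994HodgeAV] B. van Geemen, LNM 1594 (1994), Lemma 5.2, Thm. 6.12.
-/

noncomputable section

set_option linter.dupNamespace false

open CategoryTheory
open Literature.AlgebraicGeometry Literature.AlgebraicGeometry.Motives
open Literature.AlgebraicGeometry.HodgeTheory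
open Literature.AlgebraicGeometry.VanGeemen1994
open Literature.AlgebraicTopology.SingularHomology
open Summit.HodgeConjecture.HodgeConjecture.Ring2.Hypotheses
open Summit.HodgeConjecture.HodgeConjecture.WeilTypeLadder (WeilVariationalHodgeQuadratic)

namespace Summit.HodgeConjecture.HodgeConjecture.Ring2.AbelianAll

/-! ### §1 The residual shape of record (N76 / N75 + R∞^var) -/

/-- **`HCUpToDim 5` ⟸ [MZ] ∧ [Ko] ∧ [Sch] ∧ [M23] ∧ N76 ∧ R∞^var** — the dim ≤ 5 floor of part 8d as an edge into
typer1's class-target node. [cite: MoonenZarhin1999, Thm. 0.1] [cite: vanGeemen1994HodgeAV, Lemma 5.2 (4), Thm. 6.12]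
[cite: CharlesSchnell2014Notes, Conj. 11.3.1] -/
theorem hcUpToDim_five_of_refereed_of_anchorPointedFourfoldCells_of_variationalQuadratic
    (hred : MoonenZarhin1999_hodgeClasses_abelian_dim_le_five_of_weilClassesFourfolds)
    (hK : Koike2004_weilClasses_algebraic_hyperbolicSixfold_one)
    (hS : Schoen1998_weilClasses_algebraic_hyperbolicSixfold_three)
    (hM23 : Markman2023_weilClasses_algebraic_discOneWeilFourfold)
    (hN : IsogenyConnectedToCMAnchorFourfoldCells) (hV : WeilVariationalHodgeQuadratic) :
    ClassTargets.HCUpToDim 5 :=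
  fun A hA =>
    hodgeConjectureFor_abelian_dim_le_five_of_refereed_of_anchorPointedFourfoldCells_of_variationalQuadratic hred hK
      hS hM23 hN hV A hA

/-- **`HCUpToDim 5` ⟸ [MZ] ∧ [Ko] ∧ [Sch] ∧ [M23] ∧ N75 ∧ R∞^var** (the coarser all-cells node).
[cite: MoonenZarhin1999, Thm. 0.1] [cite: vanGeemen1994HodgeAV, Lemma 5.2 (4), Thm. 6.12] -/
theorem hcUpToDim_five_of_refereed_of_anchorPointedAllCells_of_variationalQuadratic
    (hred : MoonenZarhin1999_hodgeClasses_abelian_dim_le_five_of_weilClassesFourfolds)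
    (hK : Koike2004_weilClasses_algebraic_hyperbolicSixfold_one)
    (hS : Schoen1998_weilClasses_algebraic_hyperbolicSixfold_three)
    (hM23 : Markman2023_weilClasses_algebraic_discOneWeilFourfold)
    (hN : IsogenyConnectedToCMAnchorAllCells) (hV : WeilVariationalHodgeQuadratic) :
    ClassTargets.HCUpToDim 5 :=
  hcUpToDim_five_of_refereed_of_anchorPointedFourfoldCells_of_variationalQuadratic hred hK hS hM23
    (isogenyConnectedToCMAnchorFourfoldCells_of_allCells hN) hV

/-! ### §2 The door-B shape (`weilFamilyReach_similar` + locally algebraic anchors), closed nodes -/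

/-- **`HasLocallyAlgebraicWeilAnchorFourfoldCells`** — one locally algebraic anchor
(`HasLocallyAlgebraicWeilAnchorInClass 2 d δ`, part 8g) in every NON-SPLIT fourfold cell `(2, d, δ)` over a
squarefree `d ∉ {1, 3}` (content on the positive classes only; the disc-one cell `δ = [1]` is Markman 2023, the
fields `ℚ(i)`, `ℚ(√-3)` are Schoen / van Geemen / Koike in the tree's floor).  Closed ∀-form for the census; OPEN,
internally posed, never cited as a fact. [cite: Deligne1982HodgeCycles, proof of Thm. 4.8]
[cite: vanGeemen1994HodgeAV, Lemma 5.2 (3)–(4)] [status: open] -/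
@[conjecture] def HasLocallyAlgebraicWeilAnchorFourfoldCells : Prop :=
  ∀ d : ℕ, 0 < d → Squarefree d → d ≠ 1 → d ≠ 3 → ∀ δ : weilNormResidueGroup d,
    δ ≠ splitDiscriminantClass 2 d → HasLocallyAlgebraicWeilAnchorInClass 2 d δ

/-- **`HasLocallyAlgebraicWeilAnchorAllCells`** — one locally algebraic anchor in every realisable cell `(n, d, δ)`,
`n, d ≥ 1`.  Closed ∀-form; OPEN, internally posed, never cited as a fact.
[cite: Deligne1982HodgeCycles, proof of Thm. 4.8] [cite: vanGeemen1994HodgeAV, Lemma 5.2 (3)–(4)] [status: open] -/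
@[conjecture] def HasLocallyAlgebraicWeilAnchorAllCells : Prop :=
  ∀ n : ℕ, 0 < n → ∀ d : ℕ, 0 < d → ∀ δ : weilNormResidueGroup d, HasLocallyAlgebraicWeilAnchorInClass n d δ

/-- The all-cells node gives the fourfold-cells node. [folklore] -/
theorem hasLocallyAlgebraicWeilAnchorFourfoldCells_of_allCells (h : HasLocallyAlgebraicWeilAnchorAllCells) :
    HasLocallyAlgebraicWeilAnchorFourfoldCells :=
  fun d hd _ _ _ δ _ => h 2 two_pos d hd δ

/-- **`HCUpToDim 5` ⟸ [MZ] ∧ [Ko] ∧ [Sch] ∧ [M23] ∧ `weilFamilyReach_similar` ∧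
`HasLocallyAlgebraicWeilAnchorFourfoldCells`** — the dim ≤ 5 floor through door B (part 8g) as a census edge.
[cite: MoonenZarhin1999, Thm. 0.1] [cite: Deligne1982HodgeCycles, proof of Thm. 4.8]
[cite: vanGeemen1994HodgeAV, (5.4.1), Lemma 5.2 (3)–(4), Thm. 6.12] -/
theorem hcUpToDim_five_of_refereed_of_reachSimilar_of_anchorFourfoldCells
    (hred : MoonenZarhin1999_hodgeClasses_abelian_dim_le_five_of_weilClassesFourfolds)
    (hK : Koike2004_weilClasses_algebraic_hyperbolicSixfold_one)
    (hS : Schoen1998_weilClasses_algebraic_hyperbolicSixfold_three)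
    (hM23 : Markman2023_weilClasses_algebraic_discOneWeilFourfold)
    (hF : weilFamilyReach_similar) (hP : HasLocallyAlgebraicWeilAnchorFourfoldCells) :
    ClassTargets.HCUpToDim 5 :=
  fun A hA =>
    hodgeConjectureFor_abelian_dim_le_five_of_refereed_reachSimilar_anchorInClass hred hK hS hM23 hF hP A hA

/-- **`HCUpToDim 5` ⟸ the four refereed facts ∧ `weilFamilyReach_similar` ∧ `HasLocallyAlgebraicWeilAnchorAllCells`.**
[cite: MoonenZarhin1999, Thm. 0.1] [cite: Deligne1982HodgeCycles, proof of Thm. 4.8] -/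
theorem hcUpToDim_five_of_refereed_of_reachSimilar_of_anchorAllCells
    (hred : MoonenZarhin1999_hodgeClasses_abelian_dim_le_five_of_weilClassesFourfolds)
    (hK : Koike2004_weilClasses_algebraic_hyperbolicSixfold_one)
    (hS : Schoen1998_weilClasses_algebraic_hyperbolicSixfold_three)
    (hM23 : Markman2023_weilClasses_algebraic_discOneWeilFourfold)
    (hF : weilFamilyReach_similar) (hP : HasLocallyAlgebraicWeilAnchorAllCells) :
    ClassTargets.HCUpToDim 5 :=
  hcUpToDim_five_of_refereed_of_reachSimilar_of_anchorFourfoldCells hred hK hS hM23 hF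
    (hasLocallyAlgebraicWeilAnchorFourfoldCells_of_allCells hP)

/-- **`WeilClassesByComponent` ⟸ `weilFamilyReach_similar` ∧ `HasLocallyAlgebraicWeilAnchorAllCells`.**
[cite: Deligne1982HodgeCycles, proof of Thm. 4.8] [cite: vanGeemen1994HodgeAV, 4.14 and Lemma 5.2] -/
theorem weilClassesByComponent_of_reachSimilar_of_anchorAllCells (hF : weilFamilyReach_similar)
    (hP : HasLocallyAlgebraicWeilAnchorAllCells) : WeilClassesByComponent :=
  weilClassesByComponent_of_reachSimilar_of_anchorInClass hF fun n hn d hd δ => hP n (by omega) d hd δ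

/-- **R1 (`WeilSixfolds`) ⟸ `weilFamilyReach_similar` ∧ `HasLocallyAlgebraicWeilAnchorAllCells`.**
[cite: Deligne1982HodgeCycles, proof of Thm. 4.8] [cite: Schoen1998HodgeWeilAddendum, §10] -/
theorem weilSixfolds_of_reachSimilar_of_anchorAllCells (hF : weilFamilyReach_similar)
    (hP : HasLocallyAlgebraicWeilAnchorAllCells) : Theses.SevenfoldWeilCensus.WeilSixfolds :=
  weilSixfolds_of_reachSimilar_of_anchorInClass hF fun d hd δ => hP 3 (by norm_num) d hd δ

end Summit.HodgeConjecture.HodgeConjecture.Ring2.AbelianAll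

end
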